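import Summits.HubbardSuperconductivity.HubbardSuperconductivity.Theorems.AnisotropyChordTransferFibre3FinXDEvalW

/-!
# Route `AnisotropyChord` / H0 rotor rung: FIN per-`L` SIDE-CONDITION cell facts, `L = 17` (GM₃ cells 99–101)

Kernel facts `sdCellAnyZ 17 (49/50) 20 la lb (c, bn, aD) = true` (regime clause `mHole ≥ 0 ∧ facMI·η·(aD + b/(2+cos θ)) < c` on the cell, or vacuity), g5's `xbEval` objects, `decide +kernel`.
Prover seat `hubbard-h0-rotor-p3` g7; helper for piece A = stmt-HubbardSuperconductivity-23918 of rung 19089 (`--supports`, helper class).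
WHAT THIS IS NOT: nothing here proves superconductivity in the Hubbard model (rotor TARGET as worded stays FALSE, g15 verdict); kernel facts /
assembly for ONE conditional reduction at one `L`.
-/

set_option linter.dupNamespace false
set_option autoImplicit false

namespace Summit.HubbardSuperconductivity.HubbardSuperconductivity.Theorems.AnisotropyChord.Transfer.Fibre3

namespace FinXD

/-- side-condition cell `[2202657411415453, 2257723846700840]` of `L = 17` (`cert`). [folklore] -/
theorem sd17_99 : sdCellAnyZ 17 (49/50 : ℚ) 20 2202657411415453 2257723846700840 ((11/20 : ℚ), (15 : ℕ), (2/25 : ℚ)) = true := by (rw [← sdCellAnyZW_eq]; decide +kernel)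

/-- side-condition cell `[2257723846700840, 2314166942868362]` of `L = 17` (`cert`). [folklore] -/
theorem sd17_100 : sdCellAnyZ 17 (49/50 : ℚ) 20 2257723846700840 2314166942868362 ((11/20 : ℚ), (15 : ℕ), (2/25 : ℚ)) = true := by (rw [← sdCellAnyZW_eq]; decide +kernel)

/-- side-condition cell `[2314166942868362, 2372021116440072]` of `L = 17` (`cert`). [folklore] -/
theorem sd17_101 : sdCellAnyZ 17 (49/50 : ℚ) 20 2314166942868362 2372021116440072 ((11/20 : ℚ), (15 : ℕ), (2/25 : ℚ)) = true := by (rw [← sdCellAnyZW_eq]; decide +kernel)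

end FinXD

end Summit.HubbardSuperconductivity.HubbardSuperconductivity.Theorems.AnisotropyChord.Transfer.Fibre3
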